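import Literature.AlgebraicGeometry.Resolution.GeneralizedStabilityRankOneVT
import HarnessLib

/-!
# Generalized stability for `K(x)^h`: defect of pairs of subfields, Ostrowski steps, Lemma 5.5 (Kuhlmann 2010, §2.3, §5)

Topic: `Literature/AlgebraicGeometry/Resolution` (valued function fields). First of three files
assembling the named fact `Kuhlmann2010StabilityHenselizedRationalValueTranscendental`
(`GeneralizedStabilityRankOneVT.lean`: the henselized rational function field `K(x)^h` of rank
one with a value-transcendental generator over an algebraically closed `K` is a defectless
field = F.-V. Kuhlmann, *Elimination of ramification I*, Trans. AMS 362 (2010) =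
arXiv:1003.5678, §5, proof of (R4), pp. 18–20) from the named facts of
`GeneralizedStabilityHenselizedRational.lean` — the Lemma of Ostrowski
(`Kuhlmann2010OstrowskiLemma`, §2.3 (9)), the italicized statement of §5
(`Kuhlmann2010HenselizedRationalImmediateExt`), Lemma 5.5
(`Kuhlmann2010Lemma55ValueTranscendental`) — and "the henselization is henselian"
(`Kuhlmann2010HenselizationIsHenselian`, `Henselization.lean`), at the level of FINITE Galois
theory (`GeneralizedStabilityRankOneVTGalois.lean`, `GeneralizedStabilityRankOneVTProofs.lean`).
This file supplies the bookkeeping of the defect for PAIRS `M ≤ N` of subfields of the ambient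
valued field `(Ω, V)` and the three non-inductive steps of the printed argument:

> … the first extension in the tower is defectless by Corollary 4.2 or Proposition 3.1. This
> yields `d(E|F,v) = d(E.N|N,v) < [E.N:N] ≤ [E:F]`, that is, `(E|F,v)` cannot be immediate. …
> From the preceding lemma [Lemma 5.5] we infer that `E'` is again a henselized inertially
> generated function field of rank 1 and transcendence degree 1 with a valuation-transcendental
> generator over `K`. … Hence by Lemma 2.13, `(E|N,v)` is defectless.

## Content (everything PROVED)

* `relRamificationIndex V M N h`, `relInertiaDegree V M N h`, `relFinrank M N h`,
  `RelFinite M N h`, `IsDefectlessPair V M N h` — `e(N|M)`, `f(N|M)`, `[N : M]`, finiteness and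
  "`[N : M] = e f`" (`d(N|M) = 1`, §2.3) for subfields `M ≤ N` of `Ω`, `N` an `M`-algebra by
  inclusion (the typed `ramificationIndex`, `inertiaDegree` of `ValuationDefect.lean` for
  `V ∩ N` over `M`). DEFINITIONS, with `rel_tower` (multiplicativity of `e`, `f`, `n`,
  `GeneralizedStability.lean`), `isDefectlessPair_tower_iff` (**Lemma 2.13**: the defect is
  multiplicative — `P|M` defectless iff `N|M` and `P|N` are, for `M ≤ N ≤ P`, `P|M` finite).
* `eq_comap_of_isHenselianField`, `isDefectlessIn_of_isDefectlessPair` — over a henselian `M`,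
  `V ∩ N` is the unique extension and `d = 1` is defectlessness in the sense of
  `IsDefectlessIn` (Cor. 2.15); `isImmediateOver_of_rel_eq_one` — `e = f = 1` means immediate.
* `exists_relFinrank_eq_mul_pow`, `isDefectlessPair_of_not_dvd`,
  `isDefectlessPair_of_ringExpChar_eq_one` — Ostrowski's lemma over a henselian subfield:
  steps of degree prime to `p`, and everything in residue characteristic `0` (Cor. 2.12), are
  defectless; `isDefectlessPair_of_relFinrank_eq_ringExpChar` — **steps of degree `p` over
  `K(x)^h` are defectless**: `p = e f p^ν` with `ν ≥ 1` would make the extension immediate,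
  hence trivial by the italicized statement of §5.
* `exists_eq_henselizedAdjoin_of_relFinite` — **finite extensions of `K(x)^h` (rank one, `x`
  value-transcendental, `K` algebraically closed) are again `K(x')^h`**: Lemma 5.5 applied to
  the function field `K(x, s)`, `s` a finite generating set, whose henselization is the given
  extension (`E` is henselian by Lemma 2.3 and `E = K(x)^h(s) ⊆ K(x,s)^h`).

## Sources

* F.-V. Kuhlmann, *Elimination of ramification I: The generalized stability theorem*, Trans.
  Amer. Math. Soc. 362 (2010) 5697–5727 = arXiv:1003.5678: §1.1, §2.3 ((9), Cor. 2.12,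
  Lemma 2.13, Cor. 2.15), Lemma 2.3, §2.5, §5 (proof of (R4), pp. 18–20; Lemma 5.5).

## Rendering notes

* All typed notions are applied to `↥M`, `↥N` with `letI : Algebra M N :=
  (Subfield.inclusion h).toAlgebra`; the `rel*` definitions hide this instance so that
  statements about pairs of subfields are instance-free.
-/

noncomputable section

open IsLocalRing

namespace Literature.AlgebraicGeometry.Resolution

universe u

/-! ### Extensions `M ≤ N` of subfields of `(Ω, V)`: `e`, `f`, `n` and defectlessness -/

section Pairs

variable {Ω : Type u} [Field Ω] (V : ValuationSubring Ω)

/-- The ramification index `e(N|M) = (vN : vM)` of an extension `M ≤ N` of subfields of the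
valued field `(Ω, V)` (`ramificationIndex` of `ValuationDefect.lean` for `V ∩ N` over `M`, with
`N` an `M`-algebra by inclusion). [folklore] -/
def relRamificationIndex (M N : Subfield Ω) (h : M ≤ N) : ℕ :=
  letI : Algebra M N := (Subfield.inclusion h).toAlgebra
  ramificationIndex M (V.comap (algebraMap N Ω))

/-- The inertia degree `f(N|M) = [Nv : Mv]` of an extension `M ≤ N` of subfields of `(Ω, V)`.
[folklore] -/
def relInertiaDegree (M N : Subfield Ω) (h : M ≤ N) : ℕ :=
  letI : Algebra M N := (Subfield.inclusion h).toAlgebra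
  inertiaDegree M (V.comap (algebraMap N Ω))

/-- The degree `[N : M]` of an extension `M ≤ N` of subfields (`0` if infinite). [folklore] -/
def relFinrank (M N : Subfield Ω) (h : M ≤ N) : ℕ :=
  letI : Algebra M N := (Subfield.inclusion h).toAlgebra
  Module.finrank M N

/-- `N|M` is FINITE (as an extension of subfields of `Ω`). [folklore] -/
def RelFinite (M N : Subfield Ω) (h : M ≤ N) : Prop :=
  letI : Algebra M N := (Subfield.inclusion h).toAlgebra
  FiniteDimensional M N

/-- **`(N|M, v)` is defectless** for subfields `M ≤ N` of `(Ω, V)` in the sense of Kuhlmann 2010,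
§2.3, when `V ∩ N` is the unique extension of `V ∩ M` (the case of a henselian `M`):
`[N : M] = (vN : vM) · [Nv : Mv]`, i.e. `d(N|M, v) = 1`. [cite: Kuhlmann2010, Section 2.3] -/
def IsDefectlessPair (M N : Subfield Ω) (h : M ≤ N) : Prop :=
  relRamificationIndex V M N h * relInertiaDegree V M N h = relFinrank M N h

variable {V}

/-- `e(N|M) · f(N|M) ≤ [N : M]` for `N|M` finite (the one-extension fundamental inequality).
[folklore] -/
theorem relRamificationIndex_mul_relInertiaDegree_le {M N : Subfield Ω} (h : M ≤ N)
    (hfin : RelFinite M N h) :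
    relRamificationIndex V M N h * relInertiaDegree V M N h ≤ relFinrank M N h := by
  letI : Algebra M N := (Subfield.inclusion h).toAlgebra
  haveI : FiniteDimensional M N := hfin
  exact (ramificationIndex_mul_inertiaDegree_le_finrank M (V.comap (algebraMap N Ω))).2.2

/-- `e(N|M), f(N|M) ≥ 1` for `N|M` finite. [folklore] -/
theorem one_le_relRamificationIndex_and_relInertiaDegree {M N : Subfield Ω} (h : M ≤ N)
    (hfin : RelFinite M N h) :
    1 ≤ relRamificationIndex V M N h ∧ 1 ≤ relInertiaDegree V M N h := by
  letI : Algebra M N := (Subfield.inclusion h).toAlgebra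
  haveI : FiniteDimensional M N := hfin
  exact one_le_ramificationIndex_and_inertiaDegree M (V.comap (algebraMap N Ω))

/-- `[N : M] ≥ 1` for `N|M` finite. [folklore] -/
theorem one_le_relFinrank {M N : Subfield Ω} (h : M ≤ N) (hfin : RelFinite M N h) :
    1 ≤ relFinrank M N h := by
  letI : Algebra M N := (Subfield.inclusion h).toAlgebra
  haveI : FiniteDimensional M N := hfin
  exact Module.finrank_pos

/-- **Multiplicativity in towers** `M ≤ N ≤ P`: `e(P|M) = e(N|M) e(P|N)`, `f(P|M) = f(N|M) f(P|N)`,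
`[P : M] = [N : M][P : N]` (the last for `P|M` finite or not, by `Module.finrank_mul_finrank`).
[folklore] -/
theorem rel_tower {M N P : Subfield Ω} (hMN : M ≤ N) (hNP : N ≤ P) :
    relRamificationIndex V M P (hMN.trans hNP) =
        relRamificationIndex V M N hMN * relRamificationIndex V N P hNP ∧
      relInertiaDegree V M P (hMN.trans hNP) =
        relInertiaDegree V M N hMN * relInertiaDegree V N P hNP ∧
      relFinrank M P (hMN.trans hNP) = relFinrank M N hMN * relFinrank N P hNP := by
  letI : Algebra M N := (Subfield.inclusion hMN).toAlgebra
  letI : Algebra N P := (Subfield.inclusion hNP).toAlgebra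
  letI : Algebra M P := (Subfield.inclusion (hMN.trans hNP)).toAlgebra
  haveI : IsScalarTower M N P := IsScalarTower.of_algebraMap_eq fun _ => rfl
  have hc : (V.comap (algebraMap P Ω)).comap (algebraMap N P) = V.comap (algebraMap N Ω) := by
    ext x; rfl
  refine ⟨?_, ?_, ?_⟩
  · unfold relRamificationIndex
    rw [ramificationIndex_tower M N (V.comap (algebraMap P Ω)), hc]
  · unfold relInertiaDegree
    rw [inertiaDegree_tower M N (V.comap (algebraMap P Ω)), hc]
  · unfold relFinrank
    rw [Module.finrank_mul_finrank M N P]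

/-- Finiteness in towers: `P|M` finite iff `N|M` and `P|N` finite. [folklore] -/
theorem relFinite_tower_iff {M N P : Subfield Ω} (hMN : M ≤ N) (hNP : N ≤ P) :
    RelFinite M P (hMN.trans hNP) ↔ RelFinite M N hMN ∧ RelFinite N P hNP := by
  letI : Algebra M N := (Subfield.inclusion hMN).toAlgebra
  letI : Algebra N P := (Subfield.inclusion hNP).toAlgebra
  letI : Algebra M P := (Subfield.inclusion (hMN.trans hNP)).toAlgebra
  haveI : IsScalarTower M N P := IsScalarTower.of_algebraMap_eq fun _ => rfl
  constructor
  · intro hP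
    haveI : FiniteDimensional M P := hP
    haveI : FiniteDimensional M N :=
      FiniteDimensional.of_injective (IsScalarTower.toAlgHom M N P).toLinearMap
        (RingHom.injective _)
    exact ⟨(inferInstance : FiniteDimensional M N), Module.Finite.of_restrictScalars_finite M N P⟩
  · rintro ⟨hN, hP⟩
    haveI : FiniteDimensional M N := hN
    haveI : FiniteDimensional N P := hP
    exact Module.Finite.trans N P

/-- **The defect is multiplicative** (Kuhlmann 2010, Lemma 2.13, "in particular" clause, for
extensions inside `(Ω, V)` with `P|M` finite): `(P|M, v)` is defectless iff `(N|M, v)` and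
`(P|N, v)` are. PROVED from multiplicativity of `e`, `f`, `n` and `e f ≤ n`.
[cite: Kuhlmann2010, Lemma 2.13] -/
theorem isDefectlessPair_tower_iff {M N P : Subfield Ω} (hMN : M ≤ N) (hNP : N ≤ P)
    (hfin : RelFinite M P (hMN.trans hNP)) :
    IsDefectlessPair V M P (hMN.trans hNP) ↔
      IsDefectlessPair V M N hMN ∧ IsDefectlessPair V N P hNP := by
  obtain ⟨hfinN, hfinP⟩ := (relFinite_tower_iff hMN hNP).mp hfin
  obtain ⟨he, hf, hn⟩ := rel_tower (V := V) hMN hNP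
  have h1 := relRamificationIndex_mul_relInertiaDegree_le (V := V) hMN hfinN
  have h2 := relRamificationIndex_mul_relInertiaDegree_le (V := V) hNP hfinP
  unfold IsDefectlessPair
  rw [he, hf, hn]
  constructor
  · intro h
    -- `(e₁f₁)(e₂f₂) = n₁ n₂` with `eᵢfᵢ ≤ nᵢ` forces equality in both
    have hprod : relRamificationIndex V M N hMN * relInertiaDegree V M N hMN *
        (relRamificationIndex V N P hNP * relInertiaDegree V N P hNP) =
        relFinrank M N hMN * relFinrank N P hNP := by rw [← h]; ring
    have hn1 := one_le_relFinrank hMN hfinN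
    have hn2 := one_le_relFinrank hNP hfinP
    constructor
    · refine le_antisymm h1 ?_
      by_contra hlt
      push Not at hlt
      have := Nat.mul_lt_mul_of_lt_of_le hlt h2 (by omega)
      omega
    · refine le_antisymm h2 ?_
      by_contra hlt
      push Not at hlt
      have := Nat.mul_lt_mul_of_le_of_lt h1 hlt (by omega)
      omega
  · rintro ⟨hA, hB⟩
    rw [← hA, ← hB]; ring

end Pairs

/-! ### Over a henselian subfield: uniqueness of the extension, defectlessness, immediacy -/

section Henselian

variable {Ω : Type u} [Field Ω] {V : ValuationSubring Ω}

/-- Elements of `N` algebraic over `M` (as elements of `Ω`) are algebraic in the `M`-algebra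
`N`. [folklore] -/
theorem relAlgebraic_of_forall {M N : Subfield Ω} (h : M ≤ N) (halg : ∀ a ∈ N, IsAlgebraic M a) :
    letI : Algebra M N := (Subfield.inclusion h).toAlgebra
    Algebra.IsAlgebraic M N := by
  letI : Algebra M N := (Subfield.inclusion h).toAlgebra
  haveI : IsScalarTower M N Ω := IsScalarTower.of_algebraMap_eq fun _ => rfl
  refine ⟨fun a => ?_⟩
  have := halg (a : Ω) a.2
  exact (isAlgebraic_algebraMap_iff (A := Ω) Subtype.val_injective).mp this

/-- A finite extension `N|M` of subfields is algebraic (elementwise, in `Ω`). [folklore] -/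
theorem forall_isAlgebraic_of_relFinite {M N : Subfield Ω} (h : M ≤ N) (hfin : RelFinite M N h) :
    ∀ a ∈ N, IsAlgebraic M a := by
  letI : Algebra M N := (Subfield.inclusion h).toAlgebra
  haveI : IsScalarTower M N Ω := IsScalarTower.of_algebraMap_eq fun _ => rfl
  haveI : FiniteDimensional M N := hfin
  intro a ha
  have : IsAlgebraic M (⟨a, ha⟩ : N) := Algebra.IsAlgebraic.isAlgebraic _
  exact (isAlgebraic_algebraMap_iff (A := Ω) Subtype.val_injective).mpr this

/-- **Uniqueness of the extension over a henselian subfield**: if `(M, V ∩ M)` is henselian and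
`N ≥ M` is algebraic over `M`, then `V ∩ N` is the only valuation ring of `N` over `V ∩ M`.
[cite: Kuhlmann2010, Section 1.1] -/
theorem eq_comap_of_isHenselianField {M N : Subfield Ω} (h : M ≤ N)
    (hM : IsHenselianField M (V.comap (algebraMap M Ω))) (halg : ∀ a ∈ N, IsAlgebraic M a) :
    letI : Algebra M N := (Subfield.inclusion h).toAlgebra
    ∀ W : ValuationSubring N, W.comap (algebraMap M N) = V.comap (algebraMap M Ω) →
      W = V.comap (algebraMap N Ω) := by
  letI : Algebra M N := (Subfield.inclusion h).toAlgebra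
  haveI : Algebra.IsAlgebraic M N := relAlgebraic_of_forall h halg
  intro W hW
  exact hM N inferInstance W (V.comap (algebraMap N Ω)) hW (by ext x; rfl)

/-- **Over a henselian subfield, `d = 1` is defectlessness**: if `V ∩ N` is the unique extension
of `V ∩ M` to the finite extension `N` and `[N : M] = e f`, then `(M, V ∩ M)` is defectless in
`N` (`IsDefectlessIn`, `ValuationDefect.lean`). [cite: Kuhlmann2010, Cor. 2.15] -/
theorem isDefectlessIn_of_isDefectlessPair {M N : Subfield Ω} (h : M ≤ N)
    (hM : IsHenselianField M (V.comap (algebraMap M Ω))) (halg : ∀ a ∈ N, IsAlgebraic M a)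
    (hd : IsDefectlessPair V M N h) :
    letI : Algebra M N := (Subfield.inclusion h).toAlgebra
    IsDefectlessIn M (V.comap (algebraMap M Ω)) N := by
  classical
  letI : Algebra M N := (Subfield.inclusion h).toAlgebra
  refine ⟨{V.comap (algebraMap N Ω)}, fun W => ?_, ?_⟩
  · rw [Finset.mem_singleton]
    constructor
    · rintro rfl; ext x; rfl
    · exact eq_comap_of_isHenselianField h hM halg W
  · rw [Finset.sum_singleton]
    exact hd

/-- **`e(N|M) = 1` means `vN = vM`**: every value of a non-zero element of `N` is the value of an
element of `M`. [folklore] -/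
theorem exists_valuation_eq_of_relRamificationIndex_eq_one {M N : Subfield Ω} (h : M ≤ N)
    (he : relRamificationIndex V M N h = 1) :
    ∀ a ∈ N, a ≠ 0 → ∃ b ∈ M, V.valuation a = V.valuation b := by
  letI : Algebra M N := (Subfield.inclusion h).toAlgebra
  intro a ha ha0
  have htop : valueSubgroup M (V.comap (algebraMap N Ω)) = ⊤ := Subgroup.index_eq_one.mp he
  have hWa : (V.comap (algebraMap N Ω)).valuation ⟨a, ha⟩ ≠ 0 :=
    (Valuation.ne_zero_iff _).mpr fun h0 => ha0 (congrArg Subtype.val h0)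
  have hmem : Units.mk0 _ hWa ∈ valueSubgroup M (V.comap (algebraMap N Ω)) :=
    htop ▸ Subgroup.mem_top _
  obtain ⟨c, -, hc⟩ := (mem_valueSubgroup_iff M (V.comap (algebraMap N Ω)) _).mp hmem
  refine ⟨c, c.2, ?_⟩
  have := congrArg (valueGroupHom N V) hc
  rw [Units.val_mk0, valueGroupHom_valuation, valueGroupHom_valuation] at this
  exact this

/-- The residue map of `V ∩ N` followed by `(V ∩ N)~ → Ṽ` is the residue map of `V`. [folklore] -/
theorem residueFieldHom_residue_comap (N : Subfield Ω) (y : V.comap (algebraMap N Ω)) :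
    residueFieldHom N V (residue _ y) = residue V ⟨((y : N) : Ω), y.2⟩ := by
  rw [residueFieldHom_residue]
  rfl

/-- **`f(N|M) = 1` means `Nv = Mv`**: every residue of `V ∩ N` is a residue of `V ∩ M`.
[folklore] -/
theorem resField_le_of_relInertiaDegree_eq_one {M N : Subfield Ω} (h : M ≤ N)
    (hf : relInertiaDegree V M N h = 1) : resField V N ≤ resField V M := by
  letI : Algebra M N := (Subfield.inclusion h).toAlgebra
  let W : ValuationSubring N := V.comap (algebraMap N Ω)
  -- `f = 1` forces `residueSubfield M W = ⊤`
  have htop : residueSubfield M W = ⊤ := by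
    have h1 : Module.finrank (residueSubfield M W) (ResidueField W) = 1 := hf
    haveI : FiniteDimensional (residueSubfield M W) (ResidueField W) :=
      Module.finite_of_finrank_eq_succ h1
    have h2 : (⊤ : IntermediateField (residueSubfield M W) (ResidueField W)) = ⊥ :=
      IntermediateField.finrank_eq_one_iff.mp (by rw [IntermediateField.finrank_top', h1])
    refine eq_top_iff.mpr fun r _ => ?_
    have hr : r ∈ (⊤ : IntermediateField (residueSubfield M W) (ResidueField W)) :=
      IntermediateField.mem_top
    rw [h2, IntermediateField.mem_bot] at hr
    obtain ⟨s, rfl⟩ := hr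
    exact s.2
  intro r hr
  obtain ⟨a, haN, rfl⟩ := (mem_resField_iff V N r).mp hr
  let y : W := ⟨⟨(a : Ω), haN⟩, a.2⟩
  have hy : residue W y ∈ residueSubfield M W := htop ▸ Subfield.mem_top _
  obtain ⟨c, hcW, hc⟩ := (mem_residueSubfield_iff M W _).mp hy
  have := congrArg (residueFieldHom N V) hc
  rw [residueFieldHom_residue_comap, residueFieldHom_residue_comap] at this
  exact (mem_resField_iff V M _).mpr ⟨⟨((c : M) : Ω), hcW⟩, c.2, this⟩

/-- **`e = f = 1` means immediate**: an extension `M ≤ N` inside `(Ω, V)` with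
`(vN : vM) = 1 = [Nv : Mv]` is immediate (`IsImmediateOver`). [folklore] -/
theorem isImmediateOver_of_rel_eq_one {M N : Subfield Ω} (h : M ≤ N)
    (he : relRamificationIndex V M N h = 1) (hf : relInertiaDegree V M N h = 1) :
    IsImmediateOver V M N :=
  ⟨exists_valuation_eq_of_relRamificationIndex_eq_one h he,
    resField_le_of_relInertiaDegree_eq_one h hf⟩

end Henselian

/-! ### Ostrowski's lemma over a henselian subfield: steps of degree prime to `p` and of degree `p` -/

section Ostrowski

variable {Ω : Type u} [Field Ω] {V : ValuationSubring Ω}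

/-- Fields related by a ring homomorphism have the same characteristic exponent. [folklore] -/
theorem ringExpChar_eq_of_ringHom {R S : Type*} [Field R] [Field S] (f : R →+* S) :
    ringExpChar R = ringExpChar S := by
  haveI : CharP S (ringChar R) := (f.charP_iff_charP (ringChar R)).mp (ringChar.charP R)
  have h : ringChar S = ringChar R := ringChar.eq S (ringChar R)
  unfold ringExpChar
  rw [h]

/-- The residue field of `V ∩ M` (for a subfield `M ≤ N`, computed inside `V ∩ N`) has the
characteristic exponent of the residue field of `V`. [folklore] -/
theorem ringExpChar_residueField_comap {M N : Subfield Ω} (h : M ≤ N) :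
    letI : Algebra M N := (Subfield.inclusion h).toAlgebra
    ringExpChar (ResidueField ((V.comap (algebraMap N Ω)).comap (algebraMap M N))) =
      ringExpChar (ResidueField V) := by
  letI : Algebra M N := (Subfield.inclusion h).toAlgebra
  have hc : (V.comap (algebraMap N Ω)).comap (algebraMap M N) = V.comap (algebraMap M Ω) := by
    ext x; rfl
  rw [congrArg (fun X : ValuationSubring M => ringExpChar (ResidueField X)) hc]
  exact ringExpChar_eq_of_ringHom (residueFieldHom M V)

/-- **Ostrowski over a henselian subfield**: for `(M, V ∩ M)` henselian and `N ≥ M` finite,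
`[N : M] = e(N|M) f(N|M) p^ν` for some `ν`, `p` the characteristic exponent of the residue field
of `V`. [cite: Kuhlmann2010, Section 2.3, (9)] -/
theorem exists_relFinrank_eq_mul_pow (hO : Kuhlmann2010OstrowskiLemma.{u}) {M N : Subfield Ω}
    (h : M ≤ N) (hM : IsHenselianField M (V.comap (algebraMap M Ω))) (hfin : RelFinite M N h) :
    ∃ ν : ℕ, relFinrank M N h = relRamificationIndex V M N h * relInertiaDegree V M N h *
      ringExpChar (ResidueField V) ^ ν := by
  letI : Algebra M N := (Subfield.inclusion h).toAlgebra
  haveI : FiniteDimensional M N := hfin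
  have huniq := eq_comap_of_isHenselianField h hM (forall_isAlgebraic_of_relFinite h hfin)
  obtain ⟨ν, hν⟩ := hO M N inferInstance (V.comap (algebraMap N Ω)) fun W hW => huniq W hW
  refine ⟨ν, ?_⟩
  rw [ringExpChar_residueField_comap h] at hν
  exact hν

/-- **Steps of degree prime to `p` are defectless**: over a henselian `M`, a finite `N ≥ M` whose
degree is not divisible by the residue characteristic exponent `p` (in particular every finite
`N` if `p = 1`… see `isDefectlessPair_of_ringExpChar_eq_one`) satisfies `[N : M] = e f`.
[cite: Kuhlmann2010, Section 2.3, (9)] -/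
theorem isDefectlessPair_of_not_dvd (hO : Kuhlmann2010OstrowskiLemma.{u}) {M N : Subfield Ω}
    (h : M ≤ N) (hM : IsHenselianField M (V.comap (algebraMap M Ω))) (hfin : RelFinite M N h)
    (hnd : ¬ ringExpChar (ResidueField V) ∣ relFinrank M N h) : IsDefectlessPair V M N h := by
  obtain ⟨ν, hν⟩ := exists_relFinrank_eq_mul_pow hO h hM hfin
  rcases Nat.eq_zero_or_pos ν with hν0 | hνpos
  · rw [hν0, pow_zero, mul_one] at hν
    exact hν.symm
  · exfalso
    obtain ⟨k, rfl⟩ : ∃ k, ν = k + 1 := ⟨ν - 1, by omega⟩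
    refine hnd ⟨relRamificationIndex V M N h * relInertiaDegree V M N h *
      ringExpChar (ResidueField V) ^ k, ?_⟩
    rw [hν]
    ring

/-- **Residue characteristic zero: every finite extension of a henselian subfield is
defectless** (Kuhlmann 2010, Cor. 2.12, through Ostrowski's lemma with `p = 1`).
[cite: Kuhlmann2010, Cor. 2.12] -/
theorem isDefectlessPair_of_ringExpChar_eq_one (hO : Kuhlmann2010OstrowskiLemma.{u})
    {M N : Subfield Ω} (h : M ≤ N) (hM : IsHenselianField M (V.comap (algebraMap M Ω)))
    (hfin : RelFinite M N h) (h1 : ringExpChar (ResidueField V) = 1) :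
    IsDefectlessPair V M N h := by
  obtain ⟨ν, hν⟩ := exists_relFinrank_eq_mul_pow hO h hM hfin
  rw [h1, one_pow, mul_one] at hν
  exact hν.symm

/-- `[M : M] = 1` in the relative sense (from `[N : M] = [M : M][N : M]` for a finite `N ≥ M`).
[folklore] -/
theorem relFinrank_self_eq_one {M N : Subfield Ω} (h : M ≤ N) (hfin : RelFinite M N h)
    (h' : M ≤ M) : relFinrank M M h' = 1 := by
  have ht := (rel_tower (V := (⊤ : ValuationSubring Ω)) h' h).2.2
  have h1 := one_le_relFinrank h hfin
  have hpos : 0 < relFinrank M N (h'.trans h) := h1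
  -- `n = r * n` with `n ≥ 1` forces `r = 1`
  by_contra hr
  rcases Nat.lt_or_gt_of_ne hr with hlt | hgt
  · have : relFinrank M M h' = 0 := by omega
    rw [this, zero_mul] at ht
    omega
  · have : relFinrank M N (h'.trans h) < relFinrank M M h' * relFinrank M N h :=
      lt_mul_of_one_lt_left hpos hgt
    omega

/-- **Steps of degree `p` over `K(x)^h` are defectless** (the use of the italicized statement of
§5 in the induction on p. 20): for `F'' = K(x)^h` of rank one with `x` value-transcendental over
the algebraically closed `K`, and `E ≥ F''` of degree `p = char exp (residue field) > 1`,
Ostrowski's lemma gives `p = e f p^ν`; `ν ≥ 1` would force `e = f = 1`, i.e. `E|F''` immediate,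
hence `E = F''` by `Kuhlmann2010HenselizedRationalImmediateExt` — absurd; so `ν = 0` and
`[E : F''] = e f`. [cite: Kuhlmann2010, Section 5, proof of Thm. 1.1 (pp. 19–20)] -/
theorem isDefectlessPair_of_relFinrank_eq_ringExpChar [IsAlgClosed Ω]
    (hH : Kuhlmann2010HenselizationIsHenselian.{u}) (hO : Kuhlmann2010OstrowskiLemma.{u})
    (hM : Kuhlmann2010HenselizedRationalImmediateExt.{u})
    {K : Subfield Ω} (hK : IsAlgClosed K) {x : Ω} (hx : IsValueTranscendentalOver V K x)
    (hr : IsRankOneValued V (henselizedAdjoin V K x))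
    {E : Subfield Ω} (hle : henselizedAdjoin V K x ≤ E) (hfin : RelFinite _ E hle)
    (hp : 1 < ringExpChar (ResidueField V))
    (hdeg : relFinrank (henselizedAdjoin V K x) E hle = ringExpChar (ResidueField V)) :
    IsDefectlessPair V (henselizedAdjoin V K x) E hle := by
  have hhens : IsHenselianField (henselizedAdjoin V K x)
      (V.comap (algebraMap (henselizedAdjoin V K x) Ω)) := hH Ω V _
  obtain ⟨ν, hν⟩ := exists_relFinrank_eq_mul_pow hO hle hhens hfin
  set p := ringExpChar (ResidueField V) with hpdef
  set e := relRamificationIndex V (henselizedAdjoin V K x) E hle with hedef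
  set f := relInertiaDegree V (henselizedAdjoin V K x) E hle with hfdef
  obtain ⟨he1, hf1⟩ := one_le_relRamificationIndex_and_relInertiaDegree (V := V) hle hfin
  rw [hdeg] at hν
  rcases Nat.eq_zero_or_pos ν with hν0 | hνpos
  · -- `ν = 0`: `p = e f`
    rw [hν0, pow_zero, mul_one] at hν
    unfold IsDefectlessPair
    rw [hdeg]
    exact hν.symm
  · -- `ν ≥ 1`: `e = f = 1`, the extension is immediate, hence trivial — absurd
    exfalso
    have hppow : p ≤ p ^ ν := by
      conv_lhs => rw [← pow_one p]
      exact Nat.pow_le_pow_right (by omega) hνpos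
    have hef : e * f = 1 := by
      by_contra hne
      have h2 : 2 ≤ e * f := by
        have : 1 ≤ e * f := Nat.one_le_iff_ne_zero.mpr (Nat.mul_ne_zero (by omega) (by omega))
        omega
      have : p < e * f * p ^ ν :=
        calc p ≤ p ^ ν := hppow
          _ < 2 * p ^ ν := by
            have : 0 < p ^ ν := Nat.pow_pos (by omega)
            omega
          _ ≤ e * f * p ^ ν := Nat.mul_le_mul_right _ h2
      omega
    have he : e = 1 := Nat.eq_one_of_mul_eq_one_right hef
    have hf : f = 1 := Nat.eq_one_of_mul_eq_one_left hef
    have himm : IsImmediateOver V (henselizedAdjoin V K x) E :=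
      isImmediateOver_of_rel_eq_one hle he hf
    have hEq : E = henselizedAdjoin V K x :=
      hM Ω V K hK x hx hr E hle (forall_isAlgebraic_of_relFinite hle hfin) himm
    subst hEq
    have h1 : relFinrank (henselizedAdjoin V K x) (henselizedAdjoin V K x) hle = 1 :=
      relFinrank_self_eq_one hle hfin hle
    omega

end Ostrowski

/-! ### Finite extensions of `K(x)^h` are again of the form `K(x')^h` (Lemma 5.5) -/

section HenselizedRational

variable {Ω : Type u} [Field Ω] {V : ValuationSubring Ω}

/-- `K(x)` as a subfield is generated by `K` and `x`. [folklore] -/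
theorem adjoin_toSubfield_eq_closure (K : Subfield Ω) (S : Set Ω) :
    (IntermediateField.adjoin K S).toSubfield = Subfield.closure ((K : Set Ω) ∪ S) := by
  have hr : Set.range (algebraMap K Ω) = (K : Set Ω) := by
    ext y
    constructor
    · rintro ⟨c, rfl⟩; exact c.2
    · intro hy; exact ⟨⟨y, hy⟩, rfl⟩
  change Subfield.closure (Set.range (algebraMap K Ω) ∪ S) = _
  rw [hr]

/-- A finite extension `E` of a subfield `F'` is generated over `F'` by a finite set (the image of
a basis). [folklore] -/
theorem exists_finset_closure_eq_of_relFinite {F' E : Subfield Ω} (h : F' ≤ E)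
    (hfin : RelFinite F' E h) :
    ∃ s : Finset Ω, (↑s : Set Ω) ⊆ E ∧ Subfield.closure ((F' : Set Ω) ∪ s) = E := by
  classical
  letI : Algebra F' E := (Subfield.inclusion h).toAlgebra
  haveI : FiniteDimensional F' E := hfin
  let b := Module.finBasis F' E
  refine ⟨Finset.univ.image fun i => ((b i : E) : Ω), ?_, le_antisymm ?_ ?_⟩
  · intro y hy
    obtain ⟨i, -, rfl⟩ := Finset.mem_image.mp (Finset.mem_coe.mp hy)
    exact (b i).2
  · refine Subfield.closure_le.mpr ?_
    rintro y (hy | hy)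
    · exact h hy
    · obtain ⟨i, -, rfl⟩ := Finset.mem_image.mp (Finset.mem_coe.mp hy)
      exact (b i).2
  · intro e he
    have hrepr := b.sum_repr ⟨e, he⟩
    have hcoe : ((∑ i, b.repr ⟨e, he⟩ i • b i : E) : Ω) = e := congrArg Subtype.val hrepr
    rw [← hcoe]
    change E.subtype (∑ i, b.repr ⟨e, he⟩ i • b i) ∈ _
    rw [map_sum]
    refine Subfield.sum_mem _ fun i _ => ?_
    change ((b.repr ⟨e, he⟩ i : F') : Ω) * ((b i : E) : Ω) ∈ _
    refine Subfield.mul_mem _ ?_ ?_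
    · exact Subfield.subset_closure (Or.inl (b.repr ⟨e, he⟩ i).2)
    · refine Subfield.subset_closure (Or.inr ?_)
      exact Finset.mem_coe.mpr (Finset.mem_image.mpr ⟨i, Finset.mem_univ _, rfl⟩)

/-- Elements of `K(x)^h` are algebraic over `K(x)`. [folklore] -/
theorem isAlgebraic_of_mem_henselizedAdjoin {K : Subfield Ω} {x a : Ω}
    (ha : a ∈ henselizedAdjoin V K x) :
    IsAlgebraic (IntermediateField.adjoin K ({x} : Set Ω)) a := by
  have hs := isSeparable_of_mem_henselization V _ ha
  exact hs.isIntegral.isAlgebraic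

/-- **A finite extension of `K(x)^h` is algebraic over `K(x)`** (elementwise). [folklore] -/
theorem isAlgebraic_adjoin_of_relFinite {K : Subfield Ω} {x : Ω} {E : Subfield Ω}
    (hle : henselizedAdjoin V K x ≤ E) (hfin : RelFinite _ E hle) {a : Ω} (ha : a ∈ E) :
    IsAlgebraic (IntermediateField.adjoin K ({x} : Set Ω)) a := by
  set Kx : Subfield Ω := (IntermediateField.adjoin K ({x} : Set Ω)).toSubfield with hKx
  set F' : Subfield Ω := henselizedAdjoin V K x with hF'
  have hKF : Kx ≤ F' := adjoin_le_henselizedAdjoin V K x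
  letI : Algebra Kx F' := (Subfield.inclusion hKF).toAlgebra
  haveI : IsScalarTower Kx F' Ω := IsScalarTower.of_algebraMap_eq fun _ => rfl
  haveI : Algebra.IsIntegral Kx F' := ⟨fun y => by
    have hy : IsAlgebraic (IntermediateField.adjoin K ({x} : Set Ω)) (y : Ω) :=
      isAlgebraic_of_mem_henselizedAdjoin y.2
    have hy' : IsAlgebraic Kx (y : Ω) := hy
    exact ((isAlgebraic_algebraMap_iff (R := Kx) (A := Ω) Subtype.val_injective).mp
      hy').isIntegral⟩
  have h1 : IsAlgebraic F' a := forall_isAlgebraic_of_relFinite hle hfin a ha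
  have h2 : IsIntegral Kx a := isIntegral_trans (R := Kx) a h1.isIntegral
  exact h2.isAlgebraic

/-- **`K(x)^h` is henselian** (`Kuhlmann2010HenselizationIsHenselian`). [cite: Kuhlmann2010, Lemma 2.3] -/
theorem isHenselianField_henselizedAdjoin [IsAlgClosed Ω]
    (hH : Kuhlmann2010HenselizationIsHenselian.{u}) (K : Subfield Ω) (x : Ω) :
    IsHenselianField (henselizedAdjoin V K x) (V.comap (algebraMap (henselizedAdjoin V K x) Ω)) :=
  hH Ω V _

/-- **An algebraic extension of `K(x)^h` inside `Ω` is henselian** (Lemma 2.3, first part).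
[cite: Kuhlmann2010, Lemma 2.3] -/
theorem isHenselianField_of_henselizedAdjoin_le [IsAlgClosed Ω]
    (hH : Kuhlmann2010HenselizationIsHenselian.{u}) {K : Subfield Ω} {x : Ω} {E : Subfield Ω}
    (hle : henselizedAdjoin V K x ≤ E) (halg : ∀ a ∈ E, IsAlgebraic (henselizedAdjoin V K x) a) :
    IsHenselianField E (V.comap (algebraMap E Ω)) := by
  letI : Algebra (henselizedAdjoin V K x) E := (Subfield.inclusion hle).toAlgebra
  haveI : Algebra.IsAlgebraic (henselizedAdjoin V K x) E := relAlgebraic_of_forall hle halg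
  exact (isHenselianField_henselizedAdjoin hH K x).of_isAlgebraic (V.comap (algebraMap E Ω))
    (by ext y; rfl)

/-- **Finite extensions of `K(x)^h` are again henselized rational** (the use of Lemma 5.5 in the
induction on p. 20: "From the preceding lemma we infer that `E'` is again a henselized inertially
generated function field of rank 1 and transcendence degree 1 with a valuation-transcendental
generator over `K`"): for `K` algebraically closed, `x` value-transcendental, `K(x)^h` of rank
one and `E ≥ K(x)^h` finite, `E = K(x')^h` for some value-transcendental `x' ∈ E`. PROVED from
`Kuhlmann2010Lemma55ValueTranscendental` applied to the function field `F₁ = K(x, s)` (`s` a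
finite generating set of `E` over `K(x)^h`), whose henselization is `E`: `E` is henselian
(Lemma 2.3) and contains `F₁`, and `F₁^h ⊇ K(x)^h ∪ s`. [cite: Kuhlmann2010, Lemma 5.5] -/
theorem exists_eq_henselizedAdjoin_of_relFinite [IsAlgClosed Ω]
    (hH : Kuhlmann2010HenselizationIsHenselian.{u})
    (h55 : Kuhlmann2010Lemma55ValueTranscendental.{u})
    {K : Subfield Ω} (hK : IsAlgClosed K) {x : Ω} (hx : IsValueTranscendentalOver V K x)
    (hr : IsRankOneValued V (henselizedAdjoin V K x)) {E : Subfield Ω}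
    (hle : henselizedAdjoin V K x ≤ E) (hfin : RelFinite _ E hle) :
    ∃ x' ∈ E, IsValueTranscendentalOver V K x' ∧ E = henselizedAdjoin V K x' := by
  classical
  obtain ⟨s, hsE, hsgen⟩ := exists_finset_closure_eq_of_relFinite hle hfin
  set Kx : Subfield Ω := (IntermediateField.adjoin K ({x} : Set Ω)).toSubfield with hKx
  have hKxE : Kx ≤ E := (adjoin_le_henselizedAdjoin V K x).trans hle
  have hKE : K ≤ E := (le_henselizedAdjoin V K x).trans hle
  have hxE : x ∈ E := hle (mem_henselizedAdjoin_self V K x)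
  -- the function field `F₁ = K(x, s)`
  let F₁ : Subfield Ω := Subfield.closure ((K : Set Ω) ∪ ↑(insert x s))
  have hKF₁ : K ≤ F₁ := fun c hc => Subfield.subset_closure (Or.inl hc)
  have hxF₁ : x ∈ F₁ := Subfield.subset_closure (Or.inr (Finset.mem_insert_self x s))
  have hsF₁ : (↑s : Set Ω) ⊆ F₁ := fun y hy =>
    Subfield.subset_closure (Or.inr (Finset.mem_insert_of_mem hy))
  have hFG : FGOver K F₁ := ⟨insert x s, rfl⟩
  have hKxF₁ : Kx ≤ F₁ := by
    rw [hKx, adjoin_toSubfield_eq_closure]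
    refine Subfield.closure_le.mpr ?_
    rintro y (hy | hy)
    · exact hKF₁ hy
    · rw [Set.mem_singleton_iff.mp hy]; exact hxF₁
  have hF₁E : F₁ ≤ E := by
    refine Subfield.closure_le.mpr ?_
    rintro y (hy | hy)
    · exact hKE hy
    · rcases Finset.mem_insert.mp hy with rfl | hy
      · exact hxE
      · exact hsE hy
  -- `E` is henselian, so `F₁^h ≤ E`; and `E = K(x)^h(s) ≤ F₁^h`
  have halgE : ∀ a ∈ E, IsAlgebraic (henselizedAdjoin V K x) a :=
    forall_isAlgebraic_of_relFinite hle hfin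
  have hEh : IsHenselianField E (V.comap (algebraMap E Ω)) :=
    isHenselianField_of_henselizedAdjoin_le hH hle halgE
  have h1 : henselization V F₁ ≤ E := henselization_le_of_isHenselianField V F₁ hF₁E hEh
  have h2 : E ≤ henselization V F₁ := by
    rw [← hsgen]
    refine Subfield.closure_le.mpr ?_
    rintro y (hy | hy)
    · exact henselization_mono V hH hKxF₁ hy
    · exact le_henselization V F₁ (hsF₁ hy)
  have hE : henselization V F₁ = E := le_antisymm h1 h2
  -- `F₁` is algebraic over `K(x)`
  have halg : ∀ a ∈ F₁, IsAlgebraic (IntermediateField.adjoin K ({x} : Set Ω)) a :=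
    fun a ha => isAlgebraic_adjoin_of_relFinite hle hfin (hF₁E ha)
  -- rank one of `F₁^h = E`
  have hrE : IsRankOneValued V (henselization V F₁) := by
    rw [hE]
    exact hr.of_algebraic V hle fun a ha => halgE a ha
  obtain ⟨x', hx'E, hx', hEq⟩ := h55 Ω V K F₁ hK hKF₁ hFG x hxF₁ hx halg hrE
  rw [hE] at hx'E hEq
  exact ⟨x', hx'E, hx', hEq⟩

end HenselizedRational

end Literature.AlgebraicGeometry.Resolution
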